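import Literature.MathematicalPhysics.QuantumFieldTheory.Balaban1983to89.B9Eq342GreenPrimeTowerDecayRowClosed
import Literature.MathematicalPhysics.QuantumFieldTheory.Balaban1983to89.B9Eq342MajorantReadingSeam
import Literature.MathematicalPhysics.QuantumFieldTheory.Balaban1983to89.B9Eq341TowerBlockGeometry
import Literature.MathematicalPhysics.QuantumFieldTheory.Balaban1983to89.B9Eq349BlockMultipliers

/-!
# `Balaban1983to89.B9Eq342TowerValueRowMajorant` — T. Bałaban, *Propagators for lattice gauge theories in a background field*, Commun. Math. Phys. **99** (1985)
# 389–434 [Balaban1985BackgroundPropagators] Thm 3.1 (3.42)₁ p. 397 with [Balaban1984PropagatorsII] (2.51) p. 232: **THE FIRST THEOREM-3.1 INPUT OF THE SECT. B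
# PROGRAMME AT THE NE9 CHAIN's `k`-LEVEL SITE PROPAGATOR — `h342_1` of `B9Thm34SectBUniform(R1).thm34_Gp_uniform` for `Gp := conj b (readA φ G′_k(U))` over the
# one-scale geometry `towerGeom`, with `B_G`, `δ₀`, `α₁` BEFORE the height, ON PRINT's CLASS** — the OWNER's decayed value row
# `B9Eq342GreenPrimeTowerDecayRowClosed.exists_decayRow_GpOfUk` (`‖(G′_k(U)f)(x₀)‖ ≤ B·e^{−κ′d_m(Πx₀,v)}·‖f‖_∞` for sources in one big block) pushed through the seam
# `B9Eq342MajorantReadingSeam.hasMajorant_conj_readA_of_blockRowW`; junction item (j4)₁ of the NE9 lineage's route memo `ROUTE-J-VIA-THM34-g98.md`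

statement-level skeleton of published theorems with citation tags; proofs where landed; nothing here is a claim about the Yang–Mills mass gap

CITATION HEADER (lean-in-tree rule).  Audit cell `pub-balaban`, sub-cell `t4`, BINDER row NE9; NE9 crux-team LEAF PROVER 01 (`b2b-balaban-t4-ne9-formalise-leaf-01`,
gen 99; bears_on: R4/N22).  Vocabulary BY NAME: the OWNER's `B9Eq342GreenPrimeTowerDecayRowClosed.exists_decayRow_GpOfUk` (t4-ne9-p1 g95; the cell's Kato-domination road to (3.42)₁ on its
MODEL — NOT print's random-walk proof), `B9Eq349BlockMultipliers.exists_block_clm_family` (the big-block projections), this lineage's `B9Eq342MajorantReadingSeam`,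
`B9Eq341TowerBlockGeometry` (`towerGeom`, `len_towerGeom`, `tdist1_le_card_mul_tdist`, `blkK_eq_blockCoord_siteCast`), `B9Eq357QprimeTowerKernelForm.blkK`,
`B9Eq324PenaltyKernelForm.readA`, r06's `B9Eq352DivFormLetters.conj`, `B9Thm34Ext.toB6`, pv08's `B6RandomWalk.HasMajorant` ∕ `hasMajorant_mono`.  Sources read through those
files' verbatim quotations: [Balaban1985BackgroundPropagators] p. 397 Thm 3.1 «|(G′(U)λ)(x)| ≦ B₀(Lʲη)²e^{−δ₀d(y,y′)}|λ| for x ∈ Δ(y), y ∈ Λ_j, supp λ ⊂ Δ(y′)», «constants … dependent on d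
and L only»; [Balaban1984PropagatorsII] p. 232 (2.51).  [folklore] COMPOSITION BY NAME; NOTHING of print's proofs is reproduced.

WHAT IS PROVED (sorry-free; proof lane — no `def`).
* **`exists_hasMajorant_GpOfUk`** — `∃ α₁ B_G δ₀ > 0` BEFORE the height such that, at every height `n` on print's diagonal `ηL^{n+1} = 1`, `c₀(L^{n+1})^d = c₁`, every period `m`,
  every background of the chain's class (`hRS`, `U(b) ∈ U1`, `star U = U⁻¹`, `‖U(b) − 1‖ ≤ αη` with `α ≤ α₁`, geometric level profile `ε_j ≤ αr^j` in `U1` with contractive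
  transporters), ANY positivity witness `hpos′`, ANY geometry parameters `M, R_r, H`:
  `HasMajorant (toB6 (towerGeom L m n η M) R_r H) (fun p => blkK p.1) (conj b (readA φ (G′_k(U)))) (fun a a′ => B_G·len(a)²·e^{−δ₀·d(a,a′)})` — LITERALLY the hypothesis
  `h342_1` of `thm34_Gp_uniform` at `Gp := conj b (readA φ (GpOfUk …))`, `g := towerGeom …`, `blk := blkK`; `δ₀ := κ′∕d` (ℓ¹ vs sup distance), `len² = 1` on the diagonal.
HONEST SCOPE.  Composition of the owner's row (whose constants are the cell's crude closed forms at `k := d`, NOT print's `B₀(d, L)`), the seam and the geometry; the row is the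
cell's MODEL of (3.42)₁ («NE9 ⇐ the named binders»: O-NE9-1, #5 UNRULED); the gradient ∕ adjoint-side inputs `h342_2`, `h342_3` are NOT here (next files); no estimate of the paper is
asserted beyond what the named files prove; NE9 NOT PRINTED ∕ NOT PROVED; spine PROVED 0∕9; rung (B)+1 finite T⁴ — NOT infinite volume, NOT mass gap, NOT BetaPertH, NOT Clay.  HONEST
DEPENDENCY: continuum YM on T⁴ ⇐ BetaPertH ∧ nine spine estimates (0/9 proved); BetaPertH ⇐ (D1) ∧ (D4) ∧ CAP+tail; G-an2-4 gates asym, D1 and NE2/3/4.  NEW file; nothing modified.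
Net new unproved facts: 0.
-/

noncomputable section

open scoped BigOperators InnerProductSpace

namespace Literature.MathematicalPhysics.QuantumFieldTheory.Balaban1983to89.B9Eq342TowerValueRowMajorant

open B4Sect5Torus (TSite tdist)
open B4Sect5Proof (latticeConst latticeConst_nonneg)
open B7Prop1Explicit (U1)
open B9SectCLatticeCarrier (Bond)
open B9Eq311L2Pairing (WL2)
open B11Eq103H1Complex (SiteL2K)
open B9Eq310HessianOperator (adTransportW)
open B9Eq319QprimeTorus (blockCoord)
open B9Eq315QTower (towerP UlevOf)
open B9Eq316TowerFlatIsOneStep (towerP_eq_fineP_pow siteCast)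
open B9Eq324DeltaPrimeATower (laplacePrimeAk GpOfUk)
open B9Eq342GreenPrimeTowerDecayRowClosed (exists_decayRow_GpOfUk)
open B9Eq349BlockMultipliers (exists_block_clm_family)
open B6RandomWalk (HasMajorant hasMajorant_mono)
open B9Thm34Ext (toB6)
open B9Eq352DivFormLetters (conj)
open B9Eq324PenaltyKernelForm (readA)
open B9Eq357QprimeTowerKernelForm (blkK)
open B9Eq341TowerBlockGeometry (towerGeom len_towerGeom dist_towerGeom tdist1_le_card_mul_tdist blkK_eq_blockCoord_siteCast)
open B9Eq342MajorantReadingSeam (hasMajorant_conj_readA_of_blockRowW)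

variable {d : ℕ} (L : ℕ) [NeZero L] {𝔸 : Type*} [NormedRing 𝔸] [NormedAlgebra ℂ 𝔸] [CompleteSpace 𝔸] [NormOneClass 𝔸] [StarRing 𝔸]
  {W : Type*} [NormedAddCommGroup W] [InnerProductSpace ℂ W] [FiniteDimensional ℂ W] (φ : W ≃ₗ[ℂ] 𝔸) {a' Mφ Mφ' : ℝ}
  (hMφ : 0 ≤ Mφ) (hMφ' : 0 ≤ Mφ') (hφn : ∀ w, ‖φ w‖ ≤ Mφ * ‖w‖) (hφn' : ∀ X, ‖φ.symm X‖ ≤ Mφ' * ‖X‖) (ha' : 0 < a')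
  {r : ℝ} (hr0 : 0 ≤ r) (hr1 : r < 1)
  (τ : 𝔸 →ₗ[ℂ] ℂ) (hτ₂ : ∀ X Y : 𝔸, τ (X * Y) = τ (Y * X)) (hφτ : ∀ X Y : 𝔸, ⟪φ.symm X, φ.symm Y⟫_ℂ = τ (star X * Y))
  {ι : Type} [Fintype ι] (b : Module.Basis ι ℝ 𝔸) {M₂ : ℝ} (hM₂ : 0 ≤ M₂) (hrepr : ∀ (v : 𝔸) (i : ι), |b.repr v i| ≤ M₂ * ‖v‖)

include hMφ hMφ' hφn hφn' ha' hr0 hr1 hτ₂ hφτ hM₂ hrepr in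
/-- **`h342_1` OF `thm34_Gp_uniform` AT THE CHAIN's `G′_k(U)`, CONSTANTS BEFORE THE HEIGHT, ON PRINT's CLASS** — see the module docstring: the owner's decayed value row in the
Sect. B programme's block-majorant currency over `towerGeom`, `Gp := conj b (readA φ (G′_k(U)))`, kernel `B_G·len²·e^{−δ₀d₁}` with `δ₀ = κ′∕d`, `len² = (L^{n+1}η)² = 1`.
[cite: Balaban1985BackgroundPropagators, Thm 3.1 (3.42) p.397, (3.41) p.397; Balaban1984PropagatorsII, (2.51) p.232] -/
theorem exists_hasMajorant_GpOfUk (hd : 1 ≤ d) :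
    ∃ α₁ BG δ₀ : ℝ, 0 < α₁ ∧ 0 < BG ∧ 0 < δ₀ ∧
      ∀ (n : ℕ) (η : ℝ), η * (L : ℝ) ^ (n + 1) = 1 →
      ∀ (c₀ c₁ : ℝ) [Fact (0 < c₀)] [Fact (0 < c₁)], c₀ * ((L : ℝ) ^ (n + 1)) ^ d = c₁ →
      ∀ (m : Fin d → ℕ) [∀ i, NeZero (m i)] (U : Bond d (towerP L m (n + 1)) → 𝔸ˣ),
        (∀ (bd : Bond d (towerP L m (n + 1))) (v u : W), ⟪adTransportW φ U bd v, u⟫_ℂ = ⟪v, adTransportW φ (fun bd => (U bd)⁻¹) bd u⟫_ℂ) →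
      ∀ (α : ℝ), 0 ≤ α → α ≤ α₁ → (∀ bd, U bd ∈ U1 𝔸) → (∀ bd, ‖(U bd : 𝔸) - 1‖ ≤ α * η) →
      ∀ (εU : ℕ → ℝ), (∀ j, 0 ≤ εU j) → (∀ j < n + 1, εU j ≤ α * r ^ j) →
        (∀ (j : ℕ) (bd : Bond d (towerP L m (j + 1))), ‖(UlevOf L m (n + 1) U j bd : 𝔸) - 1‖ ≤ εU j) →
        (∀ (j : ℕ) (bd : Bond d (towerP L m (j + 1))), UlevOf L m (n + 1) U j bd ∈ U1 𝔸) →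
        (∀ bd, star (U bd : 𝔸) = ((U bd)⁻¹ : 𝔸ˣ)) →
        (∀ (j : ℕ) (bd : Bond d (towerP L m (j + 1))) (w : W), ‖adTransportW φ (UlevOf L m (n + 1) U j) bd w‖ ≤ ‖w‖) →
      ∀ (hpos' : ∀ x : SiteL2K ℂ d (towerP L m (n + 1)) c₀ W, x ≠ 0 → 0 < RCLike.re ⟪x, laplacePrimeAk L m n φ η U a' (c₁ := c₁) x⟫_ℂ)
        (M Rr : ℝ) (H : Prop),
      HasMajorant (g := toB6 (towerGeom L m n η M) Rr H) (fun p : TSite d (towerP L m (n + 1)) × ι => blkK L m n p.1)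
        (conj b (readA φ (GpOfUk L m n φ η U a' (c₁ := c₁) hpos')))
        (fun a a' => BG * (towerGeom L m n η M).len a ^ 2 * Real.exp (-(δ₀ * (towerGeom L m n η M).dist a a'))) := by
  obtain ⟨α₁, C, ρ, κ', hα₁, hC, hρ, hκ', hκ'ρ, h2κ, hrow⟩ := exists_decayRow_GpOfUk L φ (a' := a') hMφ hMφ' hφn hφn' ha' hr0 hr1 τ hτ₂ hφτ hd
  -- the owner's closed constant of the decayed value row
  set Bv : ℝ := (1 + |a'| * C) * (Real.exp (1 / 2) * 2) * (∑ l ∈ Finset.range d, (2 : ℝ) ^ (l + 1)) +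
    Real.sqrt (3 ^ d * 2 ^ d) * Real.sqrt ((Real.exp (1 / 2) * 2) * latticeConst d (Real.sqrt (1 / (4 * d + 1)) - 2 * κ')) * C with hBv_def
  have hBv : 0 ≤ Bv := by positivity
  have hSb : 0 ≤ ∑ i, ‖b i‖ := Finset.sum_nonneg fun i _ => norm_nonneg _
  have hd0 : (0 : ℝ) < d := by exact_mod_cast hd
  refine ⟨α₁, M₂ * (∑ i, ‖b i‖) * (Mφ * Mφ' * Bv) + 1, κ' / d, hα₁, by positivity, div_pos hκ' hd0, ?_⟩
  intro n η hηL c₀ c₁ _ _ hdiag m _ U hRS α hα hαle hUb hUε εU hεU hεg hLε hLb hUstar hRlev hpos' M Rr H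
  -- the big-block projections exist (no definition minted)
  obtain ⟨PS, hPS⟩ := exists_block_clm_family (𝕜 := ℂ) (w := fun _ : TSite d (towerP L m (n + 1)) => c₀) (V := W)
    (π := fun x : TSite d (towerP L m (n + 1)) => blockCoord (L ^ (n + 1)) m (siteCast (towerP_eq_fineP_pow L m (n + 1)) x))
  have hrowU := hrow n η hηL c₀ c₁ hdiag m U hRS α hα hαle hUb hUε εU hεU hεg hLε hLb hUstar hRlev hpos' PS hPS
  -- the row in the block map `blkK`
  have hT : ∀ (v : TSite d m) (f : SiteL2K ℂ d (towerP L m (n + 1)) c₀ W) (F : ℝ),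
      (∀ x, blkK L m n x ≠ v → WL2.equiv ℂ (fun _ : TSite d (towerP L m (n + 1)) => c₀) W f x = 0) →
      (∀ y, ‖WL2.equiv ℂ (fun _ : TSite d (towerP L m (n + 1)) => c₀) W f y‖ ≤ F) →
      ∀ x, ‖WL2.equiv ℂ (fun _ : TSite d (towerP L m (n + 1)) => c₀) W (GpOfUk L m n φ η U a' (c₁ := c₁) hpos' f) x‖ ≤
        (Bv * Real.exp (-(κ' * tdist m (blkK L m n x) v))) * F := by
    intro v f F hoff hbd x
    have h := hrowU v x f F (fun y hy => hoff y (by rwa [blkK_eq_blockCoord_siteCast])) hbd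
    rw [← blkK_eq_blockCoord_siteCast] at h
    simpa only [hBv_def, mul_assoc] using h
  have hmaj := hasMajorant_conj_readA_of_blockRowW φ hMφ hMφ' hφn hφn' b hM₂ hrepr (G := toB6 (towerGeom L m n η M) Rr H) (blkK L m n)
    (GpOfUk L m n φ η U a' (c₁ := c₁) hpos') (fun a a' => Bv * Real.exp (-(κ' * tdist m a a'))) hT
  refine hasMajorant_mono _ hmaj fun a a'' => ?_
  -- `len² = 1` on the diagonal and `e^{−κ′d_∞} ≤ e^{−(κ′∕d)d₁}`
  have hlen : (towerGeom L m n η M).len a = 1 := by rw [len_towerGeom, mul_comm]; exact hηL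
  have hexp : Real.exp (-(κ' * tdist m a a'')) ≤ Real.exp (-(κ' / d * (towerGeom L m n η M).dist a a'')) := by
    refine Real.exp_le_exp.mpr (neg_le_neg ?_)
    rw [dist_towerGeom]
    have h1 := tdist1_le_card_mul_tdist m a a''
    calc κ' / d * B9Thm37GlueTorus.tdist1 m a a'' ≤ κ' / d * (d * tdist m a a'') := mul_le_mul_of_nonneg_left h1 (div_pos hκ' hd0).le
      _ = κ' * tdist m a a'' := by field_simp
  rw [hlen, one_pow, mul_one]
  have hexp0 : 0 ≤ Real.exp (-(κ' * tdist m a a'')) := (Real.exp_pos _).le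
  calc M₂ * (∑ i, ‖b i‖) * (Mφ * Mφ' * (Bv * Real.exp (-(κ' * tdist m a a''))))
      = (M₂ * (∑ i, ‖b i‖) * (Mφ * Mφ' * Bv)) * Real.exp (-(κ' * tdist m a a'')) := by ring
    _ ≤ (M₂ * (∑ i, ‖b i‖) * (Mφ * Mφ' * Bv) + 1) * Real.exp (-(κ' / d * (towerGeom L m n η M).dist a a'')) :=
        mul_le_mul (by linarith) hexp hexp0 (by positivity)

end Literature.MathematicalPhysics.QuantumFieldTheory.Balaban1983to89.B9Eq342TowerValueRowMajorant

end
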